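import Mathlib
import HarnessLib
import Summits.HubbardSuperconductivity.HubbardSuperconductivity.Theorems.KLProgrammeKLRegimeVolumeLimitSiteKernelDefs

/-!
# Route `KLProgramme` — crux K3, child «VolumeLimit»: LOOP SUMS over the momentum grid are POINTWISE PRODUCTS of site kernels
# (cell gate-hubbard-kl, seat hubbard-kl-r2d-p2 g2; `--supports` the VolumeLimit child)

The position-space door into the VL text (`finalTwoLegVolLimit_of_siteDecay`, p471070) asks for an `L`-uniform summable decay
majorant and sitewise limits of the site kernel `siteKernel (Σ̂_{L,M}(ω, ·, σ))`.  The terms of a perturbative / tree expansion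
of `Σ̂` are built from propagator symbols on the grid by two operations: pointwise PRODUCTS in momentum and LOOP SUMS
`L^{-d} Σ_{q⃗} F(q⃗) G(k⃗ − q⃗)` (normalised grid convolutions — Riemann sums whose summation grid MOVES with the volume, the
source of all the momentum-space bookkeeping).  In position space the loop sum is harmless: by the convolution theorem of the
discrete torus, the site kernel of a normalised grid convolution is the POINTWISE PRODUCT of the site kernels
(`siteKernel_gridConv`; `torusFourierInv_gridConv` on the torus), so decay majorants multiply (and stay summable) and sitewise
limits multiply (`siteDecayLimit_mul`: the door's hypotheses (a) + (b) are closed under products, with the obvious constants).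
Pure torus Fourier bookkeeping (`torusFourierInv_eq_sum_torusChar`, `torusChar_add_right`, reindexing `k⃗ ↦ k⃗ + q⃗`); nothing is
asserted about the model.
-/

noncomputable section

namespace Summit.HubbardSuperconductivity.HubbardSuperconductivity.Theorems.KLRegimeSplit

set_option linter.dupNamespace false -- summit = problem name (single-conjunct summit), D-0017

open Filter Topology Finset Literature.MathematicalPhysics.QuantumLattice Literature.Probability.LatticeModels

/-! ## §1 The convolution theorem of the discrete torus, inverse form -/

section Torus

variable {d L : ℕ} [NeZero L]

/-- **Inverse DFT of a normalised grid convolution = product of inverse DFTs**: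
`𝓕⁻¹[k⃗ ↦ L^{-d} Σ_{q⃗} F(q⃗) G(k⃗ − q⃗)](x) = 𝓕⁻¹F(x) · 𝓕⁻¹G(x)` on `(ℤ/Lℤ)^d`. -/
theorem torusFourierInv_gridConv (F G : TorusSite d L → ℂ) (x : TorusSite d L) :
    torusFourierInv (fun k => ((L : ℂ) ^ d)⁻¹ * ∑ q, F q * G (k - q)) x = torusFourierInv F x * torusFourierInv G x := by
  simp only [torusFourierInv_eq_sum_torusChar]
  -- expand and swap the sums, then reindex `k ↦ k' + q`
  have hswap : ∑ k : TorusSite d L, (((L : ℂ) ^ d)⁻¹ * ∑ q, F q * G (k - q)) * torusChar k x =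
      ((L : ℂ) ^ d)⁻¹ * ((∑ q : TorusSite d L, F q * torusChar q x) * ∑ k' : TorusSite d L, G k' * torusChar k' x) := by
    calc ∑ k : TorusSite d L, (((L : ℂ) ^ d)⁻¹ * ∑ q, F q * G (k - q)) * torusChar k x
        = ((L : ℂ) ^ d)⁻¹ * ∑ k : TorusSite d L, ∑ q, F q * G (k - q) * torusChar k x := by
          rw [Finset.mul_sum]
          refine Finset.sum_congr rfl fun k _ => ?_
          rw [mul_assoc, Finset.sum_mul]
      _ = ((L : ℂ) ^ d)⁻¹ * ∑ q : TorusSite d L, ∑ k, F q * G (k - q) * torusChar k x := by rw [Finset.sum_comm]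
      _ = ((L : ℂ) ^ d)⁻¹ * ((∑ q : TorusSite d L, F q * torusChar q x) * ∑ k' : TorusSite d L, G k' * torusChar k' x) := by
          congr 1
          rw [Finset.sum_mul]
          refine Finset.sum_congr rfl fun q _ => ?_
          rw [Finset.mul_sum]
          symm
          refine Fintype.sum_equiv (Equiv.addRight q) _ _ fun k' => ?_
          simp only [Equiv.coe_addRight, add_sub_cancel_right]
          rw [torusChar_comm (k' + q) x, torusChar_add_right, torusChar_comm x k', torusChar_comm x q]
          ring
  rw [hswap]
  ring

end Torus

/-! ## §2 Site kernels: loop sums become pointwise products -/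

section Site

variable {d L : ℕ} [NeZero L]

/-- **The site kernel of a normalised grid convolution is the pointwise product of the site kernels** (centred lifts share their
support, so the product of the lifts is the lift of the product). -/
theorem siteKernel_gridConv (F G : TorusSite d L → ℂ) (z : Site d) :
    siteKernel (fun k => ((L : ℂ) ^ d)⁻¹ * ∑ q, F q * G (k - q)) z = siteKernel F z * siteKernel G z := by
  unfold siteKernel
  split_ifs with h
  · exact torusFourierInv_gridConv F G (Torus.proj L z)
  · rw [mul_zero]

/-- Iterated form: the site kernel of `L^{-d} Σ_{q⃗} F(q⃗) G(k⃗ − q⃗)` is bounded by the product of any bounds on the factors' kernels. -/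
theorem norm_siteKernel_gridConv_le (F G : TorusSite d L → ℂ) (z : Site d) {a b : ℝ}
    (hF : ‖siteKernel F z‖ ≤ a) (hG : ‖siteKernel G z‖ ≤ b) :
    ‖siteKernel (fun k => ((L : ℂ) ^ d)⁻¹ * ∑ q, F q * G (k - q)) z‖ ≤ a * b := by
  rw [siteKernel_gridConv, norm_mul]
  exact mul_le_mul hF hG (norm_nonneg _) ((norm_nonneg _).trans hF)

end Site

/-! ## §3 The door's hypotheses are closed under products -/

/-- **Decay majorants and sitewise limits multiply.**  In the quantifier shape of the position-space door: if two volume-indexed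
site families `A`, `B` have majorants `mA`, `mB` beyond `(L₀, Mstar)` (uniform in the frequency label) with `mB ≤ MB` bounded, and
sitewise limits `A∞`, `B∞` at every Matsubara integer (eventually in `L`, then in `M`), then the product family has the majorant
`MB · mA` (summable if `mA` is) and the sitewise limits `A∞ · B∞`. -/
theorem siteDecayLimit_mul
    {A B : ∀ (L M : ℕ) [NeZero L] [NeZero M], MatsubaraIdx M → Site 2 → Fin 2 → ℂ}
    {AInf BInf : ℤ → Site 2 → Fin 2 → ℂ} {mA mB : Site 2 → ℝ} {MB : ℝ} {Mstar : ℕ → ℕ} {L₀ : ℕ}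
    (hmA : ∀ (z : Site 2) (L : ℕ) [NeZero L], L₀ ≤ L → ∀ (M : ℕ) [NeZero M], Mstar L ≤ M →
      ∀ (ω : MatsubaraIdx M) (σ : Fin 2), ‖A L M ω z σ‖ ≤ mA z)
    (hmB : ∀ (z : Site 2) (L : ℕ) [NeZero L], L₀ ≤ L → ∀ (M : ℕ) [NeZero M], Mstar L ≤ M →
      ∀ (ω : MatsubaraIdx M) (σ : Fin 2), ‖B L M ω z σ‖ ≤ mB z)
    (hMB : ∀ z, mB z ≤ MB)
    (hlimA : ∀ (n : ℤ) (σ : Fin 2) (z : Site 2) (ε : ℝ), 0 < ε → ∃ L₁ : ℕ, ∀ (L : ℕ) [NeZero L], L₁ ≤ L →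
      ∃ M₁ : ℕ, ∀ (M : ℕ) [NeZero M], M₁ ≤ M → ∀ ω : MatsubaraIdx M, matsubaraInt M ω = n →
        ‖A L M ω z σ - AInf n z σ‖ ≤ ε)
    (hlimB : ∀ (n : ℤ) (σ : Fin 2) (z : Site 2) (ε : ℝ), 0 < ε → ∃ L₁ : ℕ, ∀ (L : ℕ) [NeZero L], L₁ ≤ L →
      ∃ M₁ : ℕ, ∀ (M : ℕ) [NeZero M], M₁ ≤ M → ∀ ω : MatsubaraIdx M, matsubaraInt M ω = n →
        ‖B L M ω z σ - BInf n z σ‖ ≤ ε) :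
    (∀ (z : Site 2) (L : ℕ) [NeZero L], L₀ ≤ L → ∀ (M : ℕ) [NeZero M], Mstar L ≤ M →
      ∀ (ω : MatsubaraIdx M) (σ : Fin 2), ‖A L M ω z σ * B L M ω z σ‖ ≤ MB * mA z) ∧
    (∀ (n : ℤ) (σ : Fin 2) (z : Site 2) (ε : ℝ), 0 < ε → ∃ L₁ : ℕ, ∀ (L : ℕ) [NeZero L], L₁ ≤ L →
      ∃ M₁ : ℕ, ∀ (M : ℕ) [NeZero M], M₁ ≤ M → ∀ ω : MatsubaraIdx M, matsubaraInt M ω = n →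
        ‖A L M ω z σ * B L M ω z σ - AInf n z σ * BInf n z σ‖ ≤ ε) := by
  refine ⟨fun z L _ hL M _ hM ω σ => ?_, fun n σ z ε hε => ?_⟩
  · rw [norm_mul, mul_comm]
    exact mul_le_mul ((hmB z L hL M hM ω σ).trans (hMB z)) (hmA z L hL M hM ω σ) (norm_nonneg _)
      ((norm_nonneg _).trans ((hmB z L hL M hM ω σ).trans (hMB z)))
  · -- sizes: `‖A‖ ≤ mA z`, `‖B∞‖ ≤ mB z + 1` beyond the thresholds; split `AB − A∞B∞ = A(B − B∞) + (A − A∞)B∞`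
    have hK0 : 0 < |mA z| + |MB| + 2 := by positivity
    set δ : ℝ := ε / (|mA z| + |MB| + 2) with hδ
    have hδ0 : 0 < δ := div_pos hε hK0
    obtain ⟨LA, hLA⟩ := hlimA n σ z δ hδ0
    obtain ⟨LB, hLB⟩ := hlimB n σ z (min δ 1) (lt_min hδ0 one_pos)
    refine ⟨max (max LA LB) (max L₀ 1), fun L _ hL => ?_⟩
    have hLA' : LA ≤ L := ((le_max_left _ _).trans (le_max_left _ _)).trans hL
    have hLB' : LB ≤ L := ((le_max_right _ _).trans (le_max_left _ _)).trans hL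
    have hL0 : L₀ ≤ L := ((le_max_left _ _).trans (le_max_right _ _)).trans hL
    obtain ⟨MA, hMA⟩ := hLA L hLA'
    obtain ⟨MBt, hMBt⟩ := hLB L hLB'
    refine ⟨max (max MA MBt) (Mstar L), fun M _ hM ω hω => ?_⟩
    have hMA' : MA ≤ M := ((le_max_left _ _).trans (le_max_left _ _)).trans hM
    have hMB' : MBt ≤ M := ((le_max_right _ _).trans (le_max_left _ _)).trans hM
    have hMs : Mstar L ≤ M := (le_max_right _ _).trans hM
    have h1 : ‖A L M ω z σ - AInf n z σ‖ ≤ δ := hMA M hMA' ω hω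
    have h2 : ‖B L M ω z σ - BInf n z σ‖ ≤ min δ 1 := hMBt M hMB' ω hω
    have hAz : ‖A L M ω z σ‖ ≤ |mA z| := (hmA z L hL0 M hMs ω σ).trans (le_abs_self _)
    have hBz : ‖B L M ω z σ‖ ≤ |MB| := ((hmB z L hL0 M hMs ω σ).trans (hMB z)).trans (le_abs_self _)
    have hBinf : ‖BInf n z σ‖ ≤ |MB| + 1 := by
      calc ‖BInf n z σ‖ = ‖B L M ω z σ - (B L M ω z σ - BInf n z σ)‖ := by rw [sub_sub_cancel]
        _ ≤ ‖B L M ω z σ‖ + ‖B L M ω z σ - BInf n z σ‖ := norm_sub_le _ _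
        _ ≤ |MB| + 1 := add_le_add hBz (h2.trans (min_le_right _ _))
    have hsplit : A L M ω z σ * B L M ω z σ - AInf n z σ * BInf n z σ =
        A L M ω z σ * (B L M ω z σ - BInf n z σ) + (A L M ω z σ - AInf n z σ) * BInf n z σ := by ring
    calc ‖A L M ω z σ * B L M ω z σ - AInf n z σ * BInf n z σ‖
        ≤ ‖A L M ω z σ‖ * ‖B L M ω z σ - BInf n z σ‖ + ‖A L M ω z σ - AInf n z σ‖ * ‖BInf n z σ‖ := by
          rw [hsplit]
          exact (norm_add_le _ _).trans (add_le_add (norm_mul_le _ _) (norm_mul_le _ _))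
      _ ≤ |mA z| * δ + δ * (|MB| + 1) :=
          add_le_add (mul_le_mul hAz (h2.trans (min_le_left _ _)) (norm_nonneg _) (abs_nonneg _))
            (mul_le_mul h1 hBinf (norm_nonneg _) hδ0.le)
      _ = δ * (|mA z| + |MB| + 1) := by ring
      _ ≤ δ * (|mA z| + |MB| + 2) := mul_le_mul_of_nonneg_left (by linarith) hδ0.le
      _ = ε := by rw [hδ]; field_simp

end Summit.HubbardSuperconductivity.HubbardSuperconductivity.Theorems.KLRegimeSplit

end
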